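import Summits.Ventures.PercRepro.C041TriDomNormalForm

/-!
# ROW C-041 — THE FIVE ABSORBERS OF THE APART EXCESS and THE COMPLETE W-AWARE DOMINATION CRITERION (p6, gen 40;
P6-TWOEXIT-LEAN.md §52 ADDENDUM 1)

In the normal form of `C041TriDomNormalForm` (`Θ = e • Q′ + thirteen manifest cone maps`) the bare apart excess `Q′` can
be absorbed into a cone map in exactly five ways by the maps of the domination dictionary: the triangle at the inputs
`(w, w′)`, at `(w, ℓψ w′)`, at `(ℓψ w, w′)`, at `(ℓψ w, ℓψ w′)`, and the STAR TREE MAP `ℓψ(ℓψ(w) ℓψ(w′))` (the host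
`a – x`, `x – u`, `x – u′`: a tree, hence a cone map for every input).  THE FOUR FURTHER IDENTITIES (`ring`):
  `θ_△(w, ℓψ w′) = Q′ + ℓψ(w) ℓψ(w′) + ℓψ(w ℓψ(w′)) + w ℓψ(w′) + n(w′) ℓψ(w) + 2 n(w′) w`   (`thetaTri_w_ellv`),
  `θ_△(ℓψ w, w′) = Q′ + ℓψ(w) ℓψ(w′) + ℓψ(ℓψ(w) w′) + ℓψ(w) w′ + n(w) ℓψ(w′) + 2 n(w) w′`   (`thetaTri_ellv_w`),
  `θ_△(ℓψ w, ℓψ w′) = 2 Q′ + 2 ℓψ(w) ℓψ(w′) + 4 n(w) ℓψ(w′) + 4 n(w′) ℓψ(w) + n(w w′) 1 + 3 n(w) n(w′) 1`   (`thetaTri_ellv_ellv`),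
  `ℓψ(ℓψ(w) ℓψ(w′)) = Q′ + n(w) ℓψ(w′) + n(w′) ℓψ(w) + n(w w′) 1 + n(w) n(w′) 1`   (`ellv_ellv_mul_ellv`)
— so a bare `Q′` is absorbed by a whole triangle against one `RRj`, one `BX`, one `XB` colouring; by a transformed triangle
against `RB`, `RWj` (or `WRj`), `XB` (or `BX`), `RWa` (or `WRa`) and two `XW` (or `WX`) colourings; by the doubly
transformed triangle (two `Q′` at once) against two `RB`, four `WRa`, four `RWa`, one `WW` joint and three `WW` apart; and
by the star tree map against one `WRa`, one `RWa`, one `WW` joint, one `WW` apart — the last one needs NO triangle at all.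
THEOREM (FIVE ABSORBERS) (`blockMap_ex2_eq_absorb`): if the type counts cover `c, c₁, c₂, c₃, d` absorptions with leftover
`e″` (thirteen count equations), `Θ = c • θ_△(w, w′) + c₁ • θ_△(w, ℓψ w′) + c₂ • θ_△(ℓψ w, w′) + c₃ • θ_△(ℓψ w, ℓψ w′)
+ d • ℓψ(ℓψ(w) ℓψ(w′)) + e″ • Q′ + (manifest)`.  THE COMPLETE W-AWARE CRITERION (`e″ = 0`): (P) and the ZONE O-CUBE at
the host with ANY two cone zones (`K4v_blockMap_ex2_of_absorb`, `zoneOCube_blockMap_ex2_of_absorb`) and the host is a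
cone host as soon as the triangle map is a cone map (`coneHost_ex2_of_absorb`, `coneHost_ex2_of_absorb_pure`).  On the
35 five-vertex and 504 six-vertex two-exit cores this integer criterion agrees with the exact LP over the full
35-atom dictionary in every case (539 / 539, own code lean-drafts/p6/g40/crit5.py); the plain criterion of
`C041TriDomNormalForm` is the case `c₁ = c₂ = c₃ = d = 0`.
-/

namespace PercRepro

namespace ZoneZ

namespace MultiExit

open ZoneData Pendant Finset TwoExit TreeClosure RelaxedTriangle

/-! ## The four absorber identities -/

/-- `θ_△(w, ℓψ w′) = Q′ + ℓψ(w) ℓψ(w′) + ℓψ(w ℓψ(w′)) + w ℓψ(w′) + n(w′) ℓψ(w) + 2 n(w′) w`. -/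
theorem thetaTri_w_ellv (w w' : Vec6) :
    thetaTri w (ellv w') = apartExcess w w' + ellv w * ellv w' + ellv (w * ellv w') + w * ellv w'
      + nAdm w' • ellv w + (2 : ℝ) • (nAdm w' • w) := by
  ext i
  simp only [thetaTri_eq_sum, apartExcess, Pi.add_apply, Pi.mul_apply, Pi.smul_apply, smul_eq_mul, thB, thR, ellv,
    ell, nAdm, kInv]
  fin_cases i <;> simp <;> ring

/-- `θ_△(ℓψ w, w′) = Q′ + ℓψ(w) ℓψ(w′) + ℓψ(ℓψ(w) w′) + ℓψ(w) w′ + n(w) ℓψ(w′) + 2 n(w) w′`. -/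
theorem thetaTri_ellv_w (w w' : Vec6) :
    thetaTri (ellv w) w' = apartExcess w w' + ellv w * ellv w' + ellv (ellv w * w') + ellv w * w'
      + nAdm w • ellv w' + (2 : ℝ) • (nAdm w • w') := by
  ext i
  simp only [thetaTri_eq_sum, apartExcess, Pi.add_apply, Pi.mul_apply, Pi.smul_apply, smul_eq_mul, thB, thR, ellv,
    ell, nAdm, kInv]
  fin_cases i <;> simp <;> ring

/-- `θ_△(ℓψ w, ℓψ w′) = 2 Q′ + 2 ℓψ(w) ℓψ(w′) + 4 n(w) ℓψ(w′) + 4 n(w′) ℓψ(w) + n(w w′) 1 + 3 n(w) n(w′) 1`. -/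
theorem thetaTri_ellv_ellv (w w' : Vec6) :
    thetaTri (ellv w) (ellv w') = (2 : ℝ) • apartExcess w w' + (2 : ℝ) • (ellv w * ellv w')
      + (4 : ℝ) • (nAdm w • ellv w') + (4 : ℝ) • (nAdm w' • ellv w) + nAdm (w * w') • (1 : Vec6)
      + (3 : ℝ) • ((nAdm w * nAdm w') • (1 : Vec6)) := by
  ext i
  simp only [thetaTri_eq_sum, apartExcess, Pi.add_apply, Pi.mul_apply, Pi.smul_apply, Pi.one_apply, smul_eq_mul, thB,
    thR, ellv, ell, nAdm, kInv]
  fin_cases i <;> simp <;> ring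

/-- **The star tree map contains a bare apart excess**: `ℓψ(ℓψ(w) ℓψ(w′)) = Q′ + n(w) ℓψ(w′) + n(w′) ℓψ(w) + n(w w′) 1 +
n(w) n(w′) 1` (the host `a – x`, `x – u`, `x – u′`). -/
theorem ellv_ellv_mul_ellv (w w' : Vec6) :
    ellv (ellv w * ellv w') = apartExcess w w' + nAdm w • ellv w' + nAdm w' • ellv w
      + nAdm (w * w') • (1 : Vec6) + (nAdm w * nAdm w') • (1 : Vec6) := by
  ext i
  simp only [apartExcess, Pi.add_apply, Pi.mul_apply, Pi.smul_apply, Pi.one_apply, smul_eq_mul, thB, thR, ellv, ell,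
    nAdm, kInv]
  fin_cases i <;> simp <;> ring

variable {V₁ E₁ U₁ U₂ : Type} (Z₁ : ZoneData V₁ E₁ U₁ U₂) (u u' a₁ : V₁) [Fintype E₁] [DecidableEq E₁]

/-! ## THEOREM (FIVE ABSORBERS) -/

/-- **THEOREM (FIVE ABSORBERS)**: with `c` whole triangles, `c₁` / `c₂` / `c₃` transformed triangles and `d` star tree
maps covered by the type counts, the block map is those absorbers plus `e″` bare apart excesses plus manifest maps. -/
theorem blockMap_ex2_eq_absorb (c c₁ c₂ c₃ d e'' s₁ s₂ s₃ s₄ s₅ s₆ s₇ s₈ s₉ s₁₀ s₁₁ s₁₂ : ℕ)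
    (h0 : tcount Z₁ u u' a₁ (false, true, false, true, false, true) =
      c + c₁ + c₂ + 2 * c₃ + d + e'' + tcount Z₁ u u' a₁ (false, true, true, false, false, false)
        + tcount Z₁ u u' a₁ (false, false, false, true, true, false)
        + tcount Z₁ u u' a₁ (false, true, false, false, true, false))
    (h1 : tcount Z₁ u u' a₁ (false, true, false, true, true, true) = c + s₁)
    (h2 : tcount Z₁ u u' a₁ (false, true, true, false, false, false) = c₁ + c₂ + 2 * c₃ + s₂)
    (h3 : tcount Z₁ u u' a₁ (false, false, false, true, true, false) = c₂ + s₃)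
    (h4 : tcount Z₁ u u' a₁ (false, true, false, false, true, false) = c₁ + s₄)
    (h5 : tcount Z₁ u u' a₁ (true, false, true, true, true, false) = c + c₂ + s₅)
    (h6 : tcount Z₁ u u' a₁ (true, true, true, false, true, false) = c + c₁ + s₆)
    (h7 : tcount Z₁ u u' a₁ (false, false, false, true, false, false) = c₂ + 4 * c₃ + d + s₇)
    (h8 : tcount Z₁ u u' a₁ (false, true, false, false, false, false) = c₁ + 4 * c₃ + d + s₈)
    (h9 : tcount Z₁ u u' a₁ (false, false, true, true, false, false) = 2 * c₂ + s₉)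
    (h10 : tcount Z₁ u u' a₁ (true, true, false, false, false, false) = 2 * c₁ + s₁₀)
    (h11 : tcount Z₁ u u' a₁ (false, false, false, false, true, true)
      + tcount Z₁ u u' a₁ (false, false, false, false, true, false) = c₃ + d + s₁₁)
    (h12 : tcount Z₁ u u' a₁ (false, false, false, false, true, false)
      + tcount Z₁ u u' a₁ (false, false, false, false, false, false) = 3 * c₃ + d + s₁₂) (w w' : Vec6) :
    blockMap Z₁ (ex2 u u') a₁ (fun b => if b then w' else w) =
      (c : ℝ) • thetaTri w w' + (c₁ : ℝ) • thetaTri w (ellv w') + (c₂ : ℝ) • thetaTri (ellv w) w'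
        + (c₃ : ℝ) • thetaTri (ellv w) (ellv w') + (d : ℝ) • ellv (ellv w * ellv w')
        + (e'' : ℝ) • apartExcess w w'
        + (s₁ : ℝ) • ellv (w * w') + (s₂ : ℝ) • (ellv w * ellv w') + (s₃ : ℝ) • ellv (ellv w * w')
        + (s₄ : ℝ) • ellv (w * ellv w') + (s₅ : ℝ) • (ellv w * w') + (s₆ : ℝ) • (w * ellv w')
        + (tcount Z₁ u u' a₁ (true, true, true, true, true, true) : ℝ) • (w * w')
        + (s₇ : ℝ) • (nAdm w • ellv w') + (s₈ : ℝ) • (nAdm w' • ellv w) + (s₉ : ℝ) • (nAdm w • w')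
        + (s₁₀ : ℝ) • (nAdm w' • w) + (s₁₁ : ℝ) • (nAdm (w * w') • (1 : Vec6))
        + (s₁₂ : ℝ) • ((nAdm w * nAdm w') • (1 : Vec6)) := by
  have hN := blockMap_ex2_eq_normal Z₁ u u' a₁ w w'
  rw [excess, h0, h2, h3, h4] at hN
  have h11' : (tcount Z₁ u u' a₁ (false, false, false, false, true, true) : ℝ)
      + tcount Z₁ u u' a₁ (false, false, false, false, true, false) = ((c₃ + d + s₁₁ : ℕ) : ℝ) := by
    rw [← Nat.cast_add, h11]
  have h12' : (tcount Z₁ u u' a₁ (false, false, false, false, true, false) : ℝ)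
      + tcount Z₁ u u' a₁ (false, false, false, false, false, false) = ((3 * c₃ + d + s₁₂ : ℕ) : ℝ) := by
    rw [← Nat.cast_add, h12]
  rw [hN, h1, h5, h6, h7, h8, h9, h10, h11', h12', thetaTri_eq_apartExcess, thetaTri_w_ellv, thetaTri_ellv_w,
    thetaTri_ellv_ellv, ellv_ellv_mul_ellv]
  push_cast
  ext i
  simp only [Pi.add_apply, Pi.smul_apply, smul_eq_mul]
  ring

/-! ## The complete W-aware domination criterion -/

/-- **(P) AT A HOST WHOSE EXCESS IS FULLY ABSORBED, WITH TWO CONE ZONES.** -/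
theorem K4v_blockMap_ex2_of_absorb (c c₁ c₂ c₃ d s₁ s₂ s₃ s₄ s₅ s₆ s₇ s₈ s₉ s₁₀ s₁₁ s₁₂ : ℕ)
    (h0 : tcount Z₁ u u' a₁ (false, true, false, true, false, true) =
      c + c₁ + c₂ + 2 * c₃ + d + 0 + tcount Z₁ u u' a₁ (false, true, true, false, false, false)
        + tcount Z₁ u u' a₁ (false, false, false, true, true, false)
        + tcount Z₁ u u' a₁ (false, true, false, false, true, false))
    (h1 : tcount Z₁ u u' a₁ (false, true, false, true, true, true) = c + s₁)
    (h2 : tcount Z₁ u u' a₁ (false, true, true, false, false, false) = c₁ + c₂ + 2 * c₃ + s₂)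
    (h3 : tcount Z₁ u u' a₁ (false, false, false, true, true, false) = c₂ + s₃)
    (h4 : tcount Z₁ u u' a₁ (false, true, false, false, true, false) = c₁ + s₄)
    (h5 : tcount Z₁ u u' a₁ (true, false, true, true, true, false) = c + c₂ + s₅)
    (h6 : tcount Z₁ u u' a₁ (true, true, true, false, true, false) = c + c₁ + s₆)
    (h7 : tcount Z₁ u u' a₁ (false, false, false, true, false, false) = c₂ + 4 * c₃ + d + s₇)
    (h8 : tcount Z₁ u u' a₁ (false, true, false, false, false, false) = c₁ + 4 * c₃ + d + s₈)
    (h9 : tcount Z₁ u u' a₁ (false, false, true, true, false, false) = 2 * c₂ + s₉)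
    (h10 : tcount Z₁ u u' a₁ (true, true, false, false, false, false) = 2 * c₁ + s₁₀)
    (h11 : tcount Z₁ u u' a₁ (false, false, false, false, true, true)
      + tcount Z₁ u u' a₁ (false, false, false, false, true, false) = c₃ + d + s₁₁)
    (h12 : tcount Z₁ u u' a₁ (false, false, false, false, true, false)
      + tcount Z₁ u u' a₁ (false, false, false, false, false, false) = 3 * c₃ + d + s₁₂)
    {w w' : Vec6} (hw : InCone w) (hw' : InCone w') :
    K4v (blockMap Z₁ (ex2 u u') a₁ (fun b => if b then w' else w)) := by
  rw [blockMap_ex2_eq_absorb Z₁ u u' a₁ c c₁ c₂ c₃ d 0 s₁ s₂ s₃ s₄ s₅ s₆ s₇ s₈ s₉ s₁₀ s₁₁ s₁₂ h0 h1 h2 h3 h4 h5 h6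
    h7 h8 h9 h10 h11 h12]
  obtain ⟨m1, m2, m3, m4, m5, m6, m7, m8, m9, m10, m11, m12, m13⟩ := InCone_manifest hw hw'
  have hl := inCone_ellv hw
  have hl' := inCone_ellv hw'
  simp only [Nat.cast_zero, zero_smul, add_zero]
  repeat' apply K4v_add
  all_goals refine K4v_smul ?_ (by positivity)
  all_goals first
    | exact K4v_thetaTri_of_InCone hw hw'
    | exact K4v_thetaTri_of_InCone hw hl'
    | exact K4v_thetaTri_of_InCone hl hw'
    | exact K4v_thetaTri_of_InCone hl hl'
    | exact K4v_of_InCone (inCone_ellv (hl.mul hl'))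
    | exact K4v_of_InCone m1
    | exact K4v_of_InCone m2
    | exact K4v_of_InCone m3
    | exact K4v_of_InCone m4
    | exact K4v_of_InCone m5
    | exact K4v_of_InCone m6
    | exact K4v_of_InCone m7
    | exact K4v_of_InCone m8
    | exact K4v_of_InCone m9
    | exact K4v_of_InCone m10
    | exact K4v_of_InCone m11
    | exact K4v_of_InCone m12
    | exact K4v_of_InCone m13

/-- The ZONE O-CUBE at a host whose excess is fully absorbed, with two cone zones: `2F ≤ T₁ + T₂ + 2I`. -/
theorem zoneOCube_blockMap_ex2_of_absorb (c c₁ c₂ c₃ d s₁ s₂ s₃ s₄ s₅ s₆ s₇ s₈ s₉ s₁₀ s₁₁ s₁₂ : ℕ)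
    (h0 : tcount Z₁ u u' a₁ (false, true, false, true, false, true) =
      c + c₁ + c₂ + 2 * c₃ + d + 0 + tcount Z₁ u u' a₁ (false, true, true, false, false, false)
        + tcount Z₁ u u' a₁ (false, false, false, true, true, false)
        + tcount Z₁ u u' a₁ (false, true, false, false, true, false))
    (h1 : tcount Z₁ u u' a₁ (false, true, false, true, true, true) = c + s₁)
    (h2 : tcount Z₁ u u' a₁ (false, true, true, false, false, false) = c₁ + c₂ + 2 * c₃ + s₂)
    (h3 : tcount Z₁ u u' a₁ (false, false, false, true, true, false) = c₂ + s₃)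
    (h4 : tcount Z₁ u u' a₁ (false, true, false, false, true, false) = c₁ + s₄)
    (h5 : tcount Z₁ u u' a₁ (true, false, true, true, true, false) = c + c₂ + s₅)
    (h6 : tcount Z₁ u u' a₁ (true, true, true, false, true, false) = c + c₁ + s₆)
    (h7 : tcount Z₁ u u' a₁ (false, false, false, true, false, false) = c₂ + 4 * c₃ + d + s₇)
    (h8 : tcount Z₁ u u' a₁ (false, true, false, false, false, false) = c₁ + 4 * c₃ + d + s₈)
    (h9 : tcount Z₁ u u' a₁ (false, false, true, true, false, false) = 2 * c₂ + s₉)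
    (h10 : tcount Z₁ u u' a₁ (true, true, false, false, false, false) = 2 * c₁ + s₁₀)
    (h11 : tcount Z₁ u u' a₁ (false, false, false, false, true, true)
      + tcount Z₁ u u' a₁ (false, false, false, false, true, false) = c₃ + d + s₁₁)
    (h12 : tcount Z₁ u u' a₁ (false, false, false, false, true, false)
      + tcount Z₁ u u' a₁ (false, false, false, false, false, false) = 3 * c₃ + d + s₁₂)
    {w w' : Vec6} (hw : InCone w) (hw' : InCone w') :
    0 ≤ (blockMap Z₁ (ex2 u u') a₁ (fun b => if b then w' else w) 1
          - blockMap Z₁ (ex2 u u') a₁ (fun b => if b then w' else w) 0)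
        + (blockMap Z₁ (ex2 u u') a₁ (fun b => if b then w' else w) 2
          - blockMap Z₁ (ex2 u u') a₁ (fun b => if b then w' else w) 0)
        + 2 * (blockMap Z₁ (ex2 u u') a₁ (fun b => if b then w' else w) 4
          + blockMap Z₁ (ex2 u u') a₁ (fun b => if b then w' else w) 5
          - blockMap Z₁ (ex2 u u') a₁ (fun b => if b then w' else w) 3)
        - 2 * blockMap Z₁ (ex2 u u') a₁ (fun b => if b then w' else w) 0 :=
  zoneOCube_nonneg_of_K4 (K4v_blockMap_ex2_of_absorb Z₁ u u' a₁ c c₁ c₂ c₃ d s₁ s₂ s₃ s₄ s₅ s₆ s₇ s₈ s₉ s₁₀ s₁₁ s₁₂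
    h0 h1 h2 h3 h4 h5 h6 h7 h8 h9 h10 h11 h12 hw hw')

/-- **A HOST WHOSE EXCESS IS FULLY ABSORBED IS A CONE HOST AS SOON AS THE TRIANGLE MAP IS A CONE MAP.** -/
theorem coneHost_ex2_of_absorb (c c₁ c₂ c₃ d s₁ s₂ s₃ s₄ s₅ s₆ s₇ s₈ s₉ s₁₀ s₁₁ s₁₂ : ℕ)
    (h0 : tcount Z₁ u u' a₁ (false, true, false, true, false, true) =
      c + c₁ + c₂ + 2 * c₃ + d + 0 + tcount Z₁ u u' a₁ (false, true, true, false, false, false)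
        + tcount Z₁ u u' a₁ (false, false, false, true, true, false)
        + tcount Z₁ u u' a₁ (false, true, false, false, true, false))
    (h1 : tcount Z₁ u u' a₁ (false, true, false, true, true, true) = c + s₁)
    (h2 : tcount Z₁ u u' a₁ (false, true, true, false, false, false) = c₁ + c₂ + 2 * c₃ + s₂)
    (h3 : tcount Z₁ u u' a₁ (false, false, false, true, true, false) = c₂ + s₃)
    (h4 : tcount Z₁ u u' a₁ (false, true, false, false, true, false) = c₁ + s₄)
    (h5 : tcount Z₁ u u' a₁ (true, false, true, true, true, false) = c + c₂ + s₅)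
    (h6 : tcount Z₁ u u' a₁ (true, true, true, false, true, false) = c + c₁ + s₆)
    (h7 : tcount Z₁ u u' a₁ (false, false, false, true, false, false) = c₂ + 4 * c₃ + d + s₇)
    (h8 : tcount Z₁ u u' a₁ (false, true, false, false, false, false) = c₁ + 4 * c₃ + d + s₈)
    (h9 : tcount Z₁ u u' a₁ (false, false, true, true, false, false) = 2 * c₂ + s₉)
    (h10 : tcount Z₁ u u' a₁ (true, true, false, false, false, false) = 2 * c₁ + s₁₀)
    (h11 : tcount Z₁ u u' a₁ (false, false, false, false, true, true)
      + tcount Z₁ u u' a₁ (false, false, false, false, true, false) = c₃ + d + s₁₁)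
    (h12 : tcount Z₁ u u' a₁ (false, false, false, false, true, false)
      + tcount Z₁ u u' a₁ (false, false, false, false, false, false) = 3 * c₃ + d + s₁₂)
    (h : ∀ X Y : Vec6, InCone X → InCone Y → InCone (thetaTri X Y)) : ConeHost Z₁ (ex2 u u') a₁ := by
  intro w hw
  rw [bool_family_eq w, blockMap_ex2_eq_absorb Z₁ u u' a₁ c c₁ c₂ c₃ d 0 s₁ s₂ s₃ s₄ s₅ s₆ s₇ s₈ s₉ s₁₀ s₁₁ s₁₂ h0 h1
    h2 h3 h4 h5 h6 h7 h8 h9 h10 h11 h12]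
  have hw0 := hw false
  have hw1 := hw true
  obtain ⟨m1, m2, m3, m4, m5, m6, m7, m8, m9, m10, m11, m12, m13⟩ := InCone_manifest hw0 hw1
  have hl := inCone_ellv hw0
  have hl' := inCone_ellv hw1
  simp only [Nat.cast_zero, zero_smul, add_zero]
  repeat' apply InCone.add
  all_goals refine InCone.smul _ (by positivity) ?_
  all_goals first
    | exact h _ _ hw0 hw1
    | exact h _ _ hw0 hl'
    | exact h _ _ hl hw1
    | exact h _ _ hl hl'
    | exact inCone_ellv (hl.mul hl')
    | exact m1
    | exact m2
    | exact m3
    | exact m4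
    | exact m5
    | exact m6
    | exact m7
    | exact m8
    | exact m9
    | exact m10
    | exact m11
    | exact m12
    | exact m13

/-- The seed programme's target gives every host whose excess is fully absorbed: if `θ_△ (V a) (V b)` lies in the cone
for all pure inputs, the host is a cone host. -/
theorem coneHost_ex2_of_absorb_pure (c c₁ c₂ c₃ d s₁ s₂ s₃ s₄ s₅ s₆ s₇ s₈ s₉ s₁₀ s₁₁ s₁₂ : ℕ)
    (h0 : tcount Z₁ u u' a₁ (false, true, false, true, false, true) =
      c + c₁ + c₂ + 2 * c₃ + d + 0 + tcount Z₁ u u' a₁ (false, true, true, false, false, false)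
        + tcount Z₁ u u' a₁ (false, false, false, true, true, false)
        + tcount Z₁ u u' a₁ (false, true, false, false, true, false))
    (h1 : tcount Z₁ u u' a₁ (false, true, false, true, true, true) = c + s₁)
    (h2 : tcount Z₁ u u' a₁ (false, true, true, false, false, false) = c₁ + c₂ + 2 * c₃ + s₂)
    (h3 : tcount Z₁ u u' a₁ (false, false, false, true, true, false) = c₂ + s₃)
    (h4 : tcount Z₁ u u' a₁ (false, true, false, false, true, false) = c₁ + s₄)
    (h5 : tcount Z₁ u u' a₁ (true, false, true, true, true, false) = c + c₂ + s₅)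
    (h6 : tcount Z₁ u u' a₁ (true, true, true, false, true, false) = c + c₁ + s₆)
    (h7 : tcount Z₁ u u' a₁ (false, false, false, true, false, false) = c₂ + 4 * c₃ + d + s₇)
    (h8 : tcount Z₁ u u' a₁ (false, true, false, false, false, false) = c₁ + 4 * c₃ + d + s₈)
    (h9 : tcount Z₁ u u' a₁ (false, false, true, true, false, false) = 2 * c₂ + s₉)
    (h10 : tcount Z₁ u u' a₁ (true, true, false, false, false, false) = 2 * c₁ + s₁₀)
    (h11 : tcount Z₁ u u' a₁ (false, false, false, false, true, true)
      + tcount Z₁ u u' a₁ (false, false, false, false, true, false) = c₃ + d + s₁₁)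
    (h12 : tcount Z₁ u u' a₁ (false, false, false, false, true, false)
      + tcount Z₁ u u' a₁ (false, false, false, false, false, false) = 3 * c₃ + d + s₁₂)
    (h : ∀ {m m' : ℕ} (a : Fin m → ℝ) (b : Fin m' → ℝ), (∀ i, 0 ≤ a i ∧ a i ≤ 1) → (∀ j, 0 ≤ b j ∧ b j ≤ 1) →
      InCone (thetaTri (V a) (V b))) : ConeHost Z₁ (ex2 u u') a₁ :=
  coneHost_ex2_of_absorb Z₁ u u' a₁ c c₁ c₂ c₃ d s₁ s₂ s₃ s₄ s₅ s₆ s₇ s₈ s₉ s₁₀ s₁₁ s₁₂ h0 h1 h2 h3 h4 h5 h6 h7 h8 h9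
    h10 h11 h12 fun _ _ hX hY => InCone_thetaTri_of_pure h hX hY

end MultiExit

end ZoneZ

end PercRepro
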